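import Summits.Ventures.LatticeQCDFlow.Exactness.HiddenSectorNoCertificateInputs
import HarnessLib

/-!
# The printed effective sample size certifies nothing: no honest lower certificate for `ESS = Z²/E_q[w̃²]` from the proposals can
# exceed `q(H)·(1 + η)²` for a hidden sector `H` — whatever the true ESS

HONEST FRAMING: exact (Metropolis-corrected) sampling algorithms for lattice gauge theory;
figures of merit are autocorrelation/cost numbers at stated couplings and volumes; no
continuum-physics claim.

Venture `LatticeQCDFlow` (cell pub-lqcd), topic `Exactness`; FANOUT row 30 (lean-1, GEN-41).  NEW WORK of the cell, sequel of
GEN-41's `HiddenSectorNoCertificate{,Inputs}` (data model and two-point lemmas there).  The flow literature's figure of merit is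
the effective sample size `ESS = (E_q w̃)²/E_q[w̃²] = 1/(1 + χ²)`, estimated from the proposals by `(Σw̃_i)²/(N Σw̃_i²)`; GEN-40's
`IMHCouplingChiSquare{Rate,Recipe}` price the certified error bar in `1 + χ² = 1/ESS`.  Here: the hidden-sector world
`w̃₂ = w̃ + L·1_H` has `E_q[w̃₂²] ≥ L²·q(H)` and `Z₂ = Z₁ + L·q(H)`, hence `ESS₂ ≤ q(H)·(1 + η)²` once `L ≥ Z₁/(η·q(H))`
(`hiddenSector_sq_integral_ge`, **`hiddenSector_ess_le`**) — while its proposals and weight values agree with world 1's except on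
an event of probability `≤ N·q(H)`.  Consequently (**`hiddenSector_no_lower_certificate_ess`**) ANY lower-bound procedure for the
ESS that is honest in world 2 at level `α₂` reports, in world 1, `Lo ≤ q(H)·(1 + η)²` with probability `≥ 1 − α₂ − N·q(H)` —
whatever world 1's true ESS (which may be `1`): a large printed `ESS`-hat is never a certificate of mode coverage, and the `χ²`
input of the certified bars is an oracle input like `c₁` and `Z`.  No `sorry`, no new definitions, nothing cited as a fact.
-/

noncomputable section

namespace Summit.Ventures.LatticeQCDFlow.Exactness

open MeasureTheory Set
open scoped ENNReal

section HiddenSector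

variable {Ω : Type*} [MeasurableSpace Ω] {q : Measure Ω} [IsProbabilityMeasure q]

omit [MeasurableSpace Ω] in
/-- `(w̃ + L·1_H)² = w̃² + 1_H·(2Lw̃ + L²)` pointwise. [ours, bookkeeping] -/
theorem hiddenSector_sq_eq (w : Ω → ℝ) (L : ℝ) (H : Set Ω) (y : Ω) :
    (w y + H.indicator (fun _ => L) y) ^ 2 = w y ^ 2 + H.indicator (fun z => 2 * L * w z + L ^ 2) y := by
  by_cases hy : y ∈ H
  · rw [indicator_of_mem hy, indicator_of_mem hy]; ring
  · rw [indicator_of_notMem hy, indicator_of_notMem hy]; ring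

/-- **`E_q[w̃₂²] ≥ L²·q(H)`** for `w̃₂ = w̃ + L·1_H`, `w̃ ≥ 0`, `L ≥ 0`, `w̃` and `w̃²` integrable (and `E_q[w̃₂²]` is the integral of
an integrable function). [ours] -/
theorem hiddenSector_sq_integral_ge {w : Ω → ℝ} (hw : Integrable w q) (hw2 : Integrable (fun y => w y ^ 2) q)
    (hw0 : ∀ y, 0 ≤ w y) {L : ℝ} (hL : 0 ≤ L) {H : Set Ω} (hH : MeasurableSet H) :
    Integrable (fun y => (w y + H.indicator (fun _ => L) y) ^ 2) q ∧
      L ^ 2 * q.real H ≤ ∫ y, (w y + H.indicator (fun _ => L) y) ^ 2 ∂q := by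
  have hg : Integrable (fun y => 2 * L * w y + L ^ 2) q := (hw.const_mul (2 * L)).add (integrable_const _)
  have hint : Integrable (fun y => (w y + H.indicator (fun _ => L) y) ^ 2) q := by
    have : (fun y => (w y + H.indicator (fun _ => L) y) ^ 2) = fun y => w y ^ 2 + H.indicator (fun z => 2 * L * w z + L ^ 2) y :=
      funext (hiddenSector_sq_eq w L H)
    rw [this]
    exact hw2.add (hg.indicator hH)
  refine ⟨hint, ?_⟩
  -- pointwise `L²·1_H ≤ w̃₂²`
  have hpt : ∀ y, H.indicator (fun _ => L ^ 2) y ≤ (w y + H.indicator (fun _ => L) y) ^ 2 := by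
    intro y
    by_cases hy : y ∈ H
    · rw [indicator_of_mem hy, indicator_of_mem hy]
      nlinarith [hw0 y]
    · rw [indicator_of_notMem hy]; positivity
  calc L ^ 2 * q.real H = ∫ y, H.indicator (fun _ => L ^ 2) y ∂q := by
        rw [integral_indicator_const _ hH, smul_eq_mul, mul_comm]
    _ ≤ ∫ y, (w y + H.indicator (fun _ => L) y) ^ 2 ∂q :=
        integral_mono ((integrable_const _).indicator hH) hint hpt

/-- **THE HIDDEN SECTOR'S EFFECTIVE SAMPLE SIZE IS AT MOST `q(H)·(1 + η)²`**: `ESS₂ = Z₂²/E_q[w̃₂²] ≤ q(H)(1 + η)²` for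
`w̃₂ = w̃ + L·1_H`, `w̃ ≥ 0` with `w̃`, `w̃²` integrable, `Z₁ > 0`, `q(H) > 0`, `η > 0`, `L ≥ Z₁/(η·q(H))`. [ours] -/
theorem hiddenSector_ess_le {w : Ω → ℝ} (hw : Integrable w q) (hw2 : Integrable (fun y => w y ^ 2) q) (hw0 : ∀ y, 0 ≤ w y)
    (hZ : 0 < ∫ y, w y ∂q) {H : Set Ω} (hH : MeasurableSet H) (hqH : 0 < q.real H) {η : ℝ} (hη : 0 < η) {L : ℝ}
    (hL : (∫ y, w y ∂q) / (η * q.real H) ≤ L) :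
    (∫ y, (w y + H.indicator (fun _ => L) y) ∂q) ^ 2 / ∫ y, (w y + H.indicator (fun _ => L) y) ^ 2 ∂q ≤
      q.real H * (1 + η) ^ 2 := by
  have hLpos : 0 < L := lt_of_lt_of_le (by positivity) hL
  -- `Z₁ ≤ η·L·q(H)`
  have hZle : ∫ y, w y ∂q ≤ η * (L * q.real H) := by
    have := (div_le_iff₀ (mul_pos hη hqH)).1 hL
    nlinarith
  obtain ⟨_, hsq⟩ := hiddenSector_sq_integral_ge hw hw2 hw0 hLpos.le hH
  have hden : 0 < ∫ y, (w y + H.indicator (fun _ => L) y) ^ 2 ∂q := lt_of_lt_of_le (by positivity) hsq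
  rw [hiddenSector_integral hw L hH, div_le_iff₀ hden]
  -- `(Z₁ + Lq)² ≤ ((1 + η)Lq)² = q(1 + η)²·L²q ≤ q(1 + η)²·∫w̃₂²`
  have h1 : (∫ y, w y ∂q + L * q.real H) ^ 2 ≤ ((1 + η) * (L * q.real H)) ^ 2 := by
    apply pow_le_pow_left₀ (by positivity)
    nlinarith
  calc (∫ y, w y ∂q + L * q.real H) ^ 2 ≤ ((1 + η) * (L * q.real H)) ^ 2 := h1
    _ = q.real H * (1 + η) ^ 2 * (L ^ 2 * q.real H) := by ring
    _ ≤ q.real H * (1 + η) ^ 2 * ∫ y, (w y + H.indicator (fun _ => L) y) ^ 2 ∂q := by gcongr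

/-- **THE PRINTED ESS CERTIFIES NOTHING.**  `(E, P)` a probability space, `N` proposals each with law `q`, world 1's weight `w̃ ≥ 0` with
`w̃`, `w̃²` integrable, a measurable sector `H` with `q(H) > 0`, `η > 0`, `L ≥ Z₁/(η·q(H))`; a lower-bound procedure `Lo` for the
effective sample size `ESS = (E_q w̃)²/E_q[w̃²]` (`Z₁ > 0`) that is honest in the hidden-sector world 2 (`P(ESS₂ < Lo(world-2 data)) ≤ α₂`).  THEN in
world 1, `P(q(H)·(1 + η)² < Lo(world-1 data)) ≤ α₂ + N·q(H)` — whatever world 1's true ESS. [ours] -/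
theorem hiddenSector_no_lower_certificate_ess {E : Type*} [MeasurableSpace E] {P : Measure E} [IsProbabilityMeasure P] {N : ℕ}
    {Y : E → Fin N → Ω} (hYm : ∀ i, Measurable fun e => Y e i) (hY : ∀ i, P.map (fun e => Y e i) = q)
    {w : Ω → ℝ} (hw : Integrable w q) (hw2 : Integrable (fun y => w y ^ 2) q) (hw0 : ∀ y, 0 ≤ w y) (hZ : 0 < ∫ y, w y ∂q)
    {H : Set Ω} (hH : MeasurableSet H) (hqH : 0 < q.real H) {η : ℝ} (hη : 0 < η) {L : ℝ}
    (hL : (∫ y, w y ∂q) / (η * q.real H) ≤ L) (Lo : E → (Fin N → ℝ) → ℝ) {α₂ : ℝ}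
    (hmiss₂ : P.real {e | (∫ y, (w y + H.indicator (fun _ => L) y) ∂q) ^ 2 / ∫ y, (w y + H.indicator (fun _ => L) y) ^ 2 ∂q <
        Lo e (fun i => w (Y e i) + H.indicator (fun _ => L) (Y e i))} ≤ α₂) :
    P.real {e | q.real H * (1 + η) ^ 2 < Lo e (fun i => w (Y e i))} ≤ α₂ + N * q.real H := by
  have h := measureReal_lt_lower_le_of_eqOn (P := P) (eqOn_proc_of_eqOn_weights (Y := Y) Lo (hiddenSector_eqOn w L H))
    (hiddenSector_ess_le hw hw2 hw0 hZ hH hqH hη hL) hmiss₂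
  rw [compl_setOf_forall_mem] at h
  refine h.trans ?_
  have := measureReal_exists_not_mem_le (P := P) q hYm hY hH.compl
  rw [compl_compl] at this
  linarith

end HiddenSector

end Summit.Ventures.LatticeQCDFlow.Exactness
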